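import Literature.MathematicalPhysics.QuantumLattice.SchwingerOSAxioms
import Literature.Analysis.FunctionSpaces.WightmanGNSContinuity
import Mathlib.Analysis.Distribution.SchwartzSpace.Deriv
import HarnessLib

/-!
# Tensor products `F ⊗ ψ` in the last variable: line derivatives and a combination bound

Trunk **T-AQFT** (topic `MathematicalPhysics/QuantumLattice`), families `constructive-qft`,
`crit-ising`; support file of the discharge of the named fact
`Literature.MathematicalPhysics.QuantumLattice.SchwingerFamily.HasProductGrowth.hasLinearGrowth`
(Osterwalder–Schrader II, Appendix by S. Summers: E0'' implies E0').

For `F ∈ 𝓢(Eʲ, ℂ)` and `ψ ∈ 𝓢(E, ℂ)` the tensor product in the last variable,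
`(F ⊗ ψ)(z) = F(z₀, …, z_{j-1}) ψ(z_j)` (`tensorSnoc`, the recursion step of the tree's
`SchwartzMap.tensorFin`), and:

* `tensorSnocLeft ψ`, `tensorSnocRight F`: `F ⊗ ψ` is continuous linear in each factor (the tree's
  `SchwartzMap.mulCompCLM`);
* `lineDerivOp_tensorSnoc_inl/inr` and their iterates: directional derivatives along directions
  moving only the first `j` variables (resp. only the last one) fall on `F` (resp. on `ψ`),
  `∂_{(v,0)}(F ⊗ ψ) = (∂_v F) ⊗ ψ`, `∂_{(0,w)}(F ⊗ ψ) = F ⊗ ∂_w ψ`;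
* `norm_iteratedFDeriv_iteratedLineDerivOp_le`: `‖Dⁿ(∂^{m} f)(x)‖ ≤ ∏ ‖mᵢ‖ · ‖D^{n+l} f(x)‖`;
* the **combination bound** `schwartzNorm_sum_smul_le`: if `λ` is a continuous linear functional
  on `𝓢(E, ℂ)` with `‖λ φ‖ ≤ L |φ|_t`, then for every finite family
  `|∑ᵢ λ(ψᵢ) Fᵢ|_a ≤ L |∑ᵢ Fᵢ ⊗ ψᵢ|_{a+t}` (`|·|_m = schwartzNorm m`): the Schwartz norms of the
  "partial application" of `λ` to `G = ∑ᵢ Fᵢ ⊗ ψᵢ` are controlled by those of `G`, the orders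
  adding up. With the sup norm on `Eʲ⁺¹` one has `‖x'‖, ‖y‖ ≤ ‖(x', y)‖`, so no constant is lost —
  this additivity is what makes the growth index `n·s` of E0' come out of an induction on `n`.

## Sources

* K. Osterwalder, R. Schrader, *Axioms for Euclidean Green's functions II*, Comm. Math. Phys.
  42 (1975) 281–305, Appendix (S. Summers), pp. 303–305 — the consumer (there, (A6): the norms of
  the Hermite coefficient functions of `g` are bounded by `|g|_{n t}`). [OsterwalderSchraderCMP1975]
* The calculus facts are folklore.

## Mathlib and Literature

Used from Mathlib: the line-derivative operators on Schwartz space (`LineDeriv` notation `∂_{v}`,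
`∂^{m}`, `SchwartzMap.lineDerivOp_apply_eq_fderiv`, `SchwartzMap.iteratedLineDerivOp_eq_iteratedFDeriv`,
`LineDeriv.iteratedLineDerivOp_succ_left/_sum/_smul`), `HasFDerivAt.mul`, `SchwartzMap.hasFDerivAt`,
`norm_iteratedFDeriv_clm_apply_const`, `norm_iteratedFDeriv_fderiv`,
`ContinuousMultilinearMap.opNorm_le_bound`, `Fin.snoc`/`Fin.init`, `Pi.single`. From the tree:
`SchwartzMap.mulComp`, `SchwartzMap.tensorFin`, `SchwartzMap.restrictCLM` (`SchwartzTensor`),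
`SchwartzMap.mulCompCLM` (`WightmanGNSContinuity`), `schwartzNorm` (`SchwingerOSAxioms`).
-/

open scoped SchwartzMap Topology LineDeriv ContDiff
open Filter Set

noncomputable section

namespace Literature.MathematicalPhysics.QuantumLattice

variable {E : Type*} [NormedAddCommGroup E] [NormedSpace ℝ E]

/-! ### Geometry of `Eʲ⁺¹ = Eʲ × E` with the sup norm -/

section Geometry

variable {j : ℕ}

/-- The norm control required by `SchwartzMap.mulComp` for the splitting of `Eʲ⁺¹` into the first
`j` variables and the last one: `‖z‖ ≤ max ‖init z‖ ‖z_j‖`. [folklore] -/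
theorem norm_le_max_init_last (z : Fin (j + 1) → E) :
    ‖z‖ ≤ 1 * max ‖SchwartzMap.restrictCLM (E := E) Fin.castSucc z‖
      ‖(ContinuousLinearMap.proj (R := ℝ) (Fin.last j) : (Fin (j + 1) → E) →L[ℝ] E) z‖ := by
  rw [one_mul, pi_norm_le_iff_of_nonneg (by positivity)]
  intro i
  induction i using Fin.lastCases with
  | last => exact le_max_right _ _
  | cast i => exact (norm_le_pi_norm (z ∘ Fin.castSucc) i).trans (le_max_left _ _)

omit [NormedSpace ℝ E] in
/-- `‖init z‖ ≤ ‖z‖`. [folklore] -/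
theorem norm_init_le (z : Fin (j + 1) → E) : ‖Fin.init z‖ ≤ ‖z‖ :=
  (pi_norm_le_iff_of_nonneg (norm_nonneg _)).2 fun i => norm_le_pi_norm z i.castSucc

omit [NormedSpace ℝ E] in
/-- `‖(v, 0)‖ ≤ ‖v‖` for the embedding `v ↦ snoc v 0` of `Eʲ` into `Eʲ⁺¹`. [folklore] -/
theorem norm_snoc_zero_le (v : Fin j → E) : ‖(Fin.snoc v 0 : Fin (j + 1) → E)‖ ≤ ‖v‖ := by
  refine (pi_norm_le_iff_of_nonneg (norm_nonneg _)).2 fun i => ?_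
  induction i using Fin.lastCases with
  | last => simp
  | cast i => rw [Fin.snoc_castSucc]; exact norm_le_pi_norm v i

end Geometry

/-! ### The tensor product in the last variable -/

section TensorSnoc

variable {j : ℕ}

/-- **The tensor product in the last variable** `(F ⊗ ψ)(z) = F(init z) ψ(z_j)` of
`F ∈ 𝓢(Eʲ, ℂ)` and `ψ ∈ 𝓢(E, ℂ)`; literally the recursion step of `SchwartzMap.tensorFin`
(OS 1973 §2, `f₁ ⊗ ⋯ ⊗ fₙ = (f₁ ⊗ ⋯ ⊗ fₙ₋₁) ⊗ fₙ`). [folklore] -/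
def tensorSnoc (F : 𝓢((Fin j → E), ℂ)) (ψ : 𝓢(E, ℂ)) : 𝓢((Fin (j + 1) → E), ℂ) :=
  SchwartzMap.mulComp F ψ (SchwartzMap.restrictCLM Fin.castSucc)
    (ContinuousLinearMap.proj (Fin.last j)) ⟨1, norm_le_max_init_last⟩

/-- Evaluation of `tensorSnoc`. [folklore] -/
@[simp]
theorem tensorSnoc_apply (F : 𝓢((Fin j → E), ℂ)) (ψ : 𝓢(E, ℂ)) (z : Fin (j + 1) → E) :
    tensorSnoc F ψ z = F (Fin.init z) * ψ (z (Fin.last j)) := rfl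

/-- `tensorFin (j+1) φ = (tensorFin j (φ ∘ castSucc)) ⊗ φ_j` (definitional). [folklore] -/
theorem tensorFin_succ_eq_tensorSnoc (φ : Fin (j + 1) → 𝓢(E, ℂ)) :
    SchwartzMap.tensorFin (j + 1) φ =
      tensorSnoc (SchwartzMap.tensorFin j fun i => φ i.castSucc) (φ (Fin.last j)) := rfl

/-- Evaluation of `F ⊗ ψ` at `(x', y) = snoc x' y`. [folklore] -/
theorem tensorSnoc_apply_snoc (F : 𝓢((Fin j → E), ℂ)) (ψ : 𝓢(E, ℂ)) (x' : Fin j → E) (y : E) :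
    tensorSnoc F ψ (Fin.snoc x' y) = F x' * ψ y := by
  rw [tensorSnoc_apply, Fin.init_snoc, Fin.snoc_last]

/-- `F ↦ F ⊗ ψ` as a continuous linear map (`SchwartzMap.mulCompCLM`). [folklore] -/
def tensorSnocLeft (ψ : 𝓢(E, ℂ)) : 𝓢((Fin j → E), ℂ) →L[ℂ] 𝓢((Fin (j + 1) → E), ℂ) :=
  SchwartzMap.mulCompCLM ψ (SchwartzMap.restrictCLM Fin.castSucc)
    (ContinuousLinearMap.proj (Fin.last j)) ⟨1, norm_le_max_init_last⟩

/-- `tensorSnocLeft ψ F = F ⊗ ψ`. [folklore] -/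
@[simp]
theorem tensorSnocLeft_apply (ψ : 𝓢(E, ℂ)) (F : 𝓢((Fin j → E), ℂ)) :
    tensorSnocLeft ψ F = tensorSnoc F ψ := rfl

/-- `ψ ↦ F ⊗ ψ` as a continuous linear map (`SchwartzMap.mulCompCLM` with the factors swapped). [folklore] -/
def tensorSnocRight (F : 𝓢((Fin j → E), ℂ)) : 𝓢(E, ℂ) →L[ℂ] 𝓢((Fin (j + 1) → E), ℂ) :=
  SchwartzMap.mulCompCLM F (ContinuousLinearMap.proj (Fin.last j))
    (SchwartzMap.restrictCLM Fin.castSucc) ⟨1, fun z => by rw [max_comm]; exact norm_le_max_init_last z⟩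

/-- `tensorSnocRight F ψ = F ⊗ ψ`. [folklore] -/
@[simp]
theorem tensorSnocRight_apply (F : 𝓢((Fin j → E), ℂ)) (ψ : 𝓢(E, ℂ)) :
    tensorSnocRight F ψ = tensorSnoc F ψ := by
  ext z
  exact mul_comm _ _

/-- `F ⊗ ψ` is additive and homogeneous in `F`: sums. [folklore] -/
theorem tensorSnoc_sum_smul {ι : Type*} (s : Finset ι) (c : ι → ℂ) (F : ι → 𝓢((Fin j → E), ℂ))
    (ψ : 𝓢(E, ℂ)) : tensorSnoc (∑ i ∈ s, c i • F i) ψ = ∑ i ∈ s, c i • tensorSnoc (F i) ψ := by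
  rw [← tensorSnocLeft_apply, map_sum]
  exact Finset.sum_congr rfl fun i _ => by rw [map_smul, tensorSnocLeft_apply]

/-! ### Line derivatives of `F ⊗ ψ` -/

/-- The derivative of `F ⊗ ψ`. [folklore] -/
theorem hasFDerivAt_tensorSnoc (F : 𝓢((Fin j → E), ℂ)) (ψ : 𝓢(E, ℂ)) (z : Fin (j + 1) → E) :
    HasFDerivAt (tensorSnoc F ψ : (Fin (j + 1) → E) → ℂ)
      (F (Fin.init z) • ((fderiv ℝ ψ (z (Fin.last j))).comp
          (ContinuousLinearMap.proj (R := ℝ) (Fin.last j) : (Fin (j + 1) → E) →L[ℝ] E)) +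
        ψ (z (Fin.last j)) • ((fderiv ℝ F (Fin.init z)).comp
          (SchwartzMap.restrictCLM (E := E) Fin.castSucc))) z := by
  have h1 : HasFDerivAt (fun z : Fin (j + 1) → E => F (Fin.init z))
      ((fderiv ℝ F (Fin.init z)).comp (SchwartzMap.restrictCLM (E := E) Fin.castSucc)) z :=
    (F.hasFDerivAt (Fin.init z)).comp z (SchwartzMap.restrictCLM (E := E) Fin.castSucc).hasFDerivAt
  have h2 : HasFDerivAt (fun z : Fin (j + 1) → E => ψ (z (Fin.last j)))
      ((fderiv ℝ ψ (z (Fin.last j))).comp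
        (ContinuousLinearMap.proj (R := ℝ) (Fin.last j) : (Fin (j + 1) → E) →L[ℝ] E)) z :=
    (ψ.hasFDerivAt (z (Fin.last j))).comp z
      (ContinuousLinearMap.proj (R := ℝ) (Fin.last j) : (Fin (j + 1) → E) →L[ℝ] E).hasFDerivAt
  have h := h1.mul h2
  exact h

/-- **Directions in the first variables fall on the first factor**:
`∂_{(v,0)}(F ⊗ ψ) = (∂_v F) ⊗ ψ`. [folklore] -/
theorem lineDerivOp_tensorSnoc_inl (F : 𝓢((Fin j → E), ℂ)) (ψ : 𝓢(E, ℂ)) (v : Fin j → E) :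
    ∂_{(Fin.snoc v 0 : Fin (j + 1) → E)} (tensorSnoc F ψ) = tensorSnoc (∂_{v} F) ψ := by
  ext z
  rw [SchwartzMap.lineDerivOp_apply_eq_fderiv, (hasFDerivAt_tensorSnoc F ψ z).fderiv,
    tensorSnoc_apply, SchwartzMap.lineDerivOp_apply_eq_fderiv]
  simp only [add_apply, smul_apply, ContinuousLinearMap.coe_comp, Function.comp_apply,
    ContinuousLinearMap.proj_apply, Fin.snoc_last, map_zero, SchwartzMap.restrictCLM_apply, smul_eq_mul]
  have : ((Fin.snoc v (0 : E) : Fin (j + 1) → E) ∘ Fin.castSucc) = v := by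
    funext i; simp
  rw [this]
  ring

/-- **Directions in the last variable fall on the last factor**:
`∂_{(0,w)}(F ⊗ ψ) = F ⊗ ∂_w ψ`. [folklore] -/
theorem lineDerivOp_tensorSnoc_inr (F : 𝓢((Fin j → E), ℂ)) (ψ : 𝓢(E, ℂ)) (w : E) :
    ∂_{(Pi.single (Fin.last j) w : Fin (j + 1) → E)} (tensorSnoc F ψ) = tensorSnoc F (∂_{w} ψ) := by
  classical
  ext z
  rw [SchwartzMap.lineDerivOp_apply_eq_fderiv, (hasFDerivAt_tensorSnoc F ψ z).fderiv,
    tensorSnoc_apply, SchwartzMap.lineDerivOp_apply_eq_fderiv]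
  simp only [add_apply, smul_apply, ContinuousLinearMap.coe_comp, Function.comp_apply,
    ContinuousLinearMap.proj_apply, Pi.single_eq_same, SchwartzMap.restrictCLM_apply, smul_eq_mul]
  have : ((Pi.single (Fin.last j) w : Fin (j + 1) → E) ∘ Fin.castSucc) = 0 := by
    funext i
    simp
  rw [this, map_zero, mul_zero, add_zero]

/-- Iterated form of `lineDerivOp_tensorSnoc_inl`: `∂^{(v,0)}(F ⊗ ψ) = (∂^{v} F) ⊗ ψ`. [folklore] -/
theorem iteratedLineDerivOp_tensorSnoc_inl {l : ℕ} (v : Fin l → (Fin j → E))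
    (F : 𝓢((Fin j → E), ℂ)) (ψ : 𝓢(E, ℂ)) :
    ∂^{fun i => (Fin.snoc (v i) 0 : Fin (j + 1) → E)} (tensorSnoc F ψ) = tensorSnoc (∂^{v} F) ψ := by
  induction l with
  | zero => simp [LineDeriv.iteratedLineDerivOp_fin_zero]
  | succ l ih =>
    rw [LineDeriv.iteratedLineDerivOp_succ_left, LineDeriv.iteratedLineDerivOp_succ_left]
    have htail : Fin.tail (fun i : Fin (l + 1) => (Fin.snoc (v i) 0 : Fin (j + 1) → E)) =
        fun i => (Fin.snoc (Fin.tail v i) 0 : Fin (j + 1) → E) := rfl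
    rw [htail, ih (Fin.tail v), lineDerivOp_tensorSnoc_inl]

/-- Iterated form of `lineDerivOp_tensorSnoc_inr`: `∂^{(0,w)}(F ⊗ ψ) = F ⊗ ∂^{w} ψ`. [folklore] -/
theorem iteratedLineDerivOp_tensorSnoc_inr {l : ℕ} (w : Fin l → E)
    (F : 𝓢((Fin j → E), ℂ)) (ψ : 𝓢(E, ℂ)) :
    ∂^{fun i => (Pi.single (Fin.last j) (w i) : Fin (j + 1) → E)} (tensorSnoc F ψ) =
      tensorSnoc F (∂^{w} ψ) := by
  induction l with
  | zero => simp [LineDeriv.iteratedLineDerivOp_fin_zero]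
  | succ l ih =>
    rw [LineDeriv.iteratedLineDerivOp_succ_left, LineDeriv.iteratedLineDerivOp_succ_left]
    have htail : Fin.tail (fun i : Fin (l + 1) => (Pi.single (Fin.last j) (w i) : Fin (j + 1) → E)) =
        fun i => (Pi.single (Fin.last j) (Fin.tail w i) : Fin (j + 1) → E) := rfl
    rw [htail, ih (Fin.tail w), lineDerivOp_tensorSnoc_inr]

end TensorSnoc

/-! ### Derivatives of iterated line derivatives -/

section LineDerivNorm

variable {V : Type*} [NormedAddCommGroup V] [NormedSpace ℝ V]

/-- `‖Dⁿ(∂_w f)(x)‖ ≤ ‖w‖ ‖Dⁿ⁺¹ f(x)‖` (`∂_w f = (Df) w`, `norm_iteratedFDeriv_clm_apply_const`,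
`norm_iteratedFDeriv_fderiv`). [folklore] -/
theorem norm_iteratedFDeriv_lineDerivOp_le (f : 𝓢(V, ℂ)) (w : V) (n : ℕ) (x : V) :
    ‖iteratedFDeriv ℝ n (fun y => (∂_{w} f) y) x‖ ≤ ‖w‖ * ‖iteratedFDeriv ℝ (n + 1) f x‖ := by
  have hfun : (fun y : V => (∂_{w} f) y) = fun y => (fderiv ℝ f y) w :=
    funext fun y => SchwartzMap.lineDerivOp_apply_eq_fderiv w f y
  rw [hfun, ← norm_iteratedFDeriv_fderiv]
  have hsm : ContDiff ℝ ∞ (fderiv ℝ (f : V → ℂ)) := (f.smooth ⊤).fderiv_right (mod_cast le_top)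
  exact norm_iteratedFDeriv_clm_apply_const (hsm.contDiffAt) (mod_cast le_top)

/-- **Derivatives of iterated line derivatives**: `‖Dⁿ(∂^{m} f)(x)‖ ≤ ∏ᵢ ‖mᵢ‖ · ‖Dⁿ⁺ˡ f(x)‖`
for `m : Fin l → V`. [folklore] -/
theorem norm_iteratedFDeriv_iteratedLineDerivOp_le {l : ℕ} (m : Fin l → V) (f : 𝓢(V, ℂ)) (n : ℕ)
    (x : V) : ‖iteratedFDeriv ℝ n (fun y => (∂^{m} f) y) x‖ ≤ (∏ i, ‖m i‖) * ‖iteratedFDeriv ℝ (n + l) f x‖ := by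
  induction l generalizing n with
  | zero => simp [LineDeriv.iteratedLineDerivOp_fin_zero]
  | succ l ih =>
    rw [LineDeriv.iteratedLineDerivOp_succ_left, Fin.prod_univ_succ]
    calc ‖iteratedFDeriv ℝ n (fun y => (∂_{m 0} (∂^{Fin.tail m} f)) y) x‖
        ≤ ‖m 0‖ * ‖iteratedFDeriv ℝ (n + 1) (fun y => (∂^{Fin.tail m} f) y) x‖ :=
          norm_iteratedFDeriv_lineDerivOp_le _ _ n x
      _ ≤ ‖m 0‖ * ((∏ i, ‖Fin.tail m i‖) * ‖iteratedFDeriv ℝ (n + 1 + l) f x‖) :=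
          mul_le_mul_of_nonneg_left (ih (Fin.tail m) (n + 1)) (norm_nonneg _)
      _ = (‖m 0‖ * ∏ i : Fin l, ‖m i.succ‖) * ‖iteratedFDeriv ℝ (n + (l + 1)) f x‖ := by
          rw [show n + 1 + l = n + (l + 1) by omega]
          simp only [Fin.tail]
          ring

end LineDerivNorm

/-! ### The combination bound -/

section Combination

variable {j : ℕ}

/-- **Mixed derivatives of a finite sum of tensor products, pointwise**: for `G = ∑ᵢ Fᵢ ⊗ ψᵢ`,
`∑ᵢ (∂^{v} Fᵢ)(x') (∂^{w} ψᵢ)(y) = (∂^{(v,0)} ∂^{(0,w)} G)(x', y)`. [folklore] -/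
theorem sum_iteratedLineDerivOp_mul_eq {ι : Type*} (s : Finset ι) (F : ι → 𝓢((Fin j → E), ℂ))
    (ψ : ι → 𝓢(E, ℂ)) {l n : ℕ} (v : Fin l → (Fin j → E)) (w : Fin n → E) (x' : Fin j → E) (y : E) :
    ∑ i ∈ s, (∂^{v} (F i)) x' * (∂^{w} (ψ i)) y =
      (∂^{fun i => (Fin.snoc (v i) 0 : Fin (j + 1) → E)}
        (∂^{fun i => (Pi.single (Fin.last j) (w i) : Fin (j + 1) → E)}
          (∑ i ∈ s, tensorSnoc (F i) (ψ i)))) (Fin.snoc x' y) := by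
  rw [LineDeriv.iteratedLineDerivOp_sum, LineDeriv.iteratedLineDerivOp_sum]
  rw [show (∑ i ∈ s, ∂^{fun i => (Fin.snoc (v i) 0 : Fin (j + 1) → E)}
      (∂^{fun i => (Pi.single (Fin.last j) (w i) : Fin (j + 1) → E)} (tensorSnoc (F i) (ψ i))))
        (Fin.snoc x' y) = ∑ i ∈ s, (∂^{fun i => (Fin.snoc (v i) 0 : Fin (j + 1) → E)}
      (∂^{fun i => (Pi.single (Fin.last j) (w i) : Fin (j + 1) → E)} (tensorSnoc (F i) (ψ i))))
        (Fin.snoc x' y) from by simp]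
  refine Finset.sum_congr rfl fun i _ => ?_
  rw [iteratedLineDerivOp_tensorSnoc_inr, iteratedLineDerivOp_tensorSnoc_inl, tensorSnoc_apply_snoc]

/-- The Schwartz norm of order `M` is a continuous seminorm; as a function it is the `Finset.sup`
of Mathlib's seminorm family over `Iic (M, M)`. Scaling: `|c • φ|_M = ‖c‖ |φ|_M`. [folklore] -/
theorem schwartzNorm_smul {X : Type*} [NormedAddCommGroup X] [NormedSpace ℝ X] (M : ℕ) (c : ℂ)
    (φ : 𝓢(X, ℂ)) : schwartzNorm M (c • φ) = ‖c‖ * schwartzNorm M φ :=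
  map_smul_eq_mul _ c φ

/-- **The combination bound.** Let `λ` be a continuous linear functional on `𝓢(E, ℂ)` with
`‖λ φ‖ ≤ L |φ|_t`. Then for every finite family `(Fᵢ, ψᵢ)`,
`|∑ᵢ λ(ψᵢ) Fᵢ|_a ≤ L |∑ᵢ Fᵢ ⊗ ψᵢ|_{a+t}`: the weighted derivatives of `∑ᵢ λ(ψᵢ) Fᵢ` at `x'`
in directions `v` are `λ` applied to `∑ᵢ (∂^{v}Fᵢ)(x') ψᵢ`, whose Schwartz norms of order `t`
are mixed derivatives of `G = ∑ᵢ Fᵢ ⊗ ψᵢ` at `(x', y)` weighted by `‖x'‖^k ‖y‖^{k'} ≤ ‖(x',y)‖^{k+k'}`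
(sup norm). [folklore] -/
theorem schwartzNorm_sum_smul_le {ι : Type*} (s : Finset ι) (F : ι → 𝓢((Fin j → E), ℂ))
    (ψ : ι → 𝓢(E, ℂ)) (lam : 𝓢(E, ℂ) →L[ℂ] ℂ) {L : ℝ} (hL : 0 ≤ L) {t : ℕ}
    (hlam : ∀ φ, ‖lam φ‖ ≤ L * schwartzNorm t φ) (a : ℕ) :
    schwartzNorm a (∑ i ∈ s, lam (ψ i) • F i) ≤
      L * schwartzNorm (a + t) (∑ i ∈ s, tensorSnoc (F i) (ψ i)) := by
  set G : 𝓢((Fin (j + 1) → E), ℂ) := ∑ i ∈ s, tensorSnoc (F i) (ψ i) with hG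
  set Gl : 𝓢((Fin j → E), ℂ) := ∑ i ∈ s, lam (ψ i) • F i with hGl
  have hB0 : 0 ≤ L * schwartzNorm (a + t) G := mul_nonneg hL (schwartzNorm_nonneg _ _)
  refine Seminorm.finset_sup_apply_le hB0 fun kl hkl => ?_
  obtain ⟨hk, hl⟩ := Prod.mk_le_mk.1 (Finset.mem_Iic.1 hkl)
  rw [SchwartzMap.schwartzSeminormFamily_apply]
  refine SchwartzMap.seminorm_le_bound ℂ kl.1 kl.2 Gl hB0 fun x' => ?_
  -- the weighted derivative at `x'` in the directions `v`
  have key : ∀ v : Fin kl.2 → (Fin j → E),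
      ‖x'‖ ^ kl.1 * ‖iteratedFDeriv ℝ kl.2 Gl x' v‖ ≤
        L * schwartzNorm (a + t) G * ∏ i, ‖v i‖ := by
    intro v
    -- the test function fed to `λ`
    set φ : 𝓢(E, ℂ) := ∑ i ∈ s, (((‖x'‖ ^ kl.1 : ℝ) : ℂ) * (∂^{v} (F i)) x') • ψ i with hφ
    have hval : ((‖x'‖ ^ kl.1 : ℝ) : ℂ) * iteratedFDeriv ℝ kl.2 Gl x' v = lam φ := by
      rw [← SchwartzMap.iteratedLineDerivOp_eq_iteratedFDeriv, hGl, LineDeriv.iteratedLineDerivOp_sum,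
        hφ, map_sum]
      rw [show (∑ i ∈ s, ∂^{v} (lam (ψ i) • F i)) x' = ∑ i ∈ s, (∂^{v} (lam (ψ i) • F i)) x' from by simp,
        Finset.mul_sum]
      refine Finset.sum_congr rfl fun i _ => ?_
      rw [LineDeriv.iteratedLineDerivOp_smul, map_smul, smul_eq_mul, smul_apply, smul_eq_mul]
      ring
    have hnorm : ‖x'‖ ^ kl.1 * ‖iteratedFDeriv ℝ kl.2 Gl x' v‖ = ‖lam φ‖ := by
      rw [← hval, norm_mul, Complex.norm_real, Real.norm_eq_abs, abs_of_nonneg (by positivity)]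
    -- Schwartz norms of `φ` are mixed derivatives of `G`
    have hφt : schwartzNorm t φ ≤ schwartzNorm (a + t) G * ∏ i, ‖v i‖ := by
      have hC0 : 0 ≤ schwartzNorm (a + t) G * ∏ i, ‖v i‖ :=
        mul_nonneg (schwartzNorm_nonneg _ _) (Finset.prod_nonneg fun i _ => norm_nonneg _)
      refine Seminorm.finset_sup_apply_le hC0 fun kl' hkl' => ?_
      obtain ⟨hk', hl'⟩ := Prod.mk_le_mk.1 (Finset.mem_Iic.1 hkl')
      rw [SchwartzMap.schwartzSeminormFamily_apply]
      refine SchwartzMap.seminorm_le_bound ℂ kl'.1 kl'.2 φ hC0 fun y => ?_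
      have hw : ∀ w : Fin kl'.2 → E, ‖y‖ ^ kl'.1 * ‖iteratedFDeriv ℝ kl'.2 φ y w‖ ≤
          schwartzNorm (a + t) G * (∏ i, ‖v i‖) * ∏ i, ‖w i‖ := by
        intro w
        set z : Fin (j + 1) → E := Fin.snoc x' y with hz
        set H : 𝓢((Fin (j + 1) → E), ℂ) :=
          ∂^{fun i => (Pi.single (Fin.last j) (w i) : Fin (j + 1) → E)} G with hH
        -- the value of the mixed derivative
        have hmixed : iteratedFDeriv ℝ kl'.2 φ y w =
            ((‖x'‖ ^ kl.1 : ℝ) : ℂ) * (∂^{fun i => (Fin.snoc (v i) 0 : Fin (j + 1) → E)} H) z := by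
          rw [← SchwartzMap.iteratedLineDerivOp_eq_iteratedFDeriv, hφ, LineDeriv.iteratedLineDerivOp_sum,
            hH, hG, ← sum_iteratedLineDerivOp_mul_eq s F ψ v w x' y, Finset.mul_sum]
          rw [show (∑ i ∈ s, ∂^{w} ((((‖x'‖ ^ kl.1 : ℝ) : ℂ) * (∂^{v} (F i)) x') • ψ i)) y =
              ∑ i ∈ s, (∂^{w} ((((‖x'‖ ^ kl.1 : ℝ) : ℂ) * (∂^{v} (F i)) x') • ψ i)) y from by simp]
          refine Finset.sum_congr rfl fun i _ => ?_
          rw [LineDeriv.iteratedLineDerivOp_smul, smul_apply, smul_eq_mul]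
          ring
        -- its size
        have hHz : ‖(∂^{fun i => (Fin.snoc (v i) 0 : Fin (j + 1) → E)} H) z‖ ≤
            (∏ i, ‖w i‖) * ‖iteratedFDeriv ℝ (kl.2 + kl'.2) G z‖ * ∏ i, ‖v i‖ := by
          rw [SchwartzMap.iteratedLineDerivOp_eq_iteratedFDeriv]
          refine (ContinuousMultilinearMap.le_opNorm _ _).trans ?_
          have h1 : ‖iteratedFDeriv ℝ kl.2 H z‖ ≤ (∏ i, ‖w i‖) * ‖iteratedFDeriv ℝ (kl.2 + kl'.2) G z‖ := by
            refine (norm_iteratedFDeriv_iteratedLineDerivOp_le _ G kl.2 z).trans ?_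
            gcongr with i
            exact (Pi.norm_single (G := fun _ : Fin (j + 1) => E) (w i)).le
          have h2 : ∏ i, ‖(Fin.snoc (v i) 0 : Fin (j + 1) → E)‖ ≤ ∏ i, ‖v i‖ :=
            Finset.prod_le_prod (fun i _ => norm_nonneg _) fun i _ => norm_snoc_zero_le (v i)
          exact mul_le_mul h1 h2 (Finset.prod_nonneg fun i _ => norm_nonneg _)
            (mul_nonneg (Finset.prod_nonneg fun i _ => norm_nonneg _) (norm_nonneg _))
        -- weights: `‖x'‖, ‖y‖ ≤ ‖z‖`
        have hx' : ‖x'‖ ≤ ‖z‖ := by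
          have h := norm_init_le z
          rwa [hz, Fin.init_snoc] at h
        have hy : ‖y‖ ≤ ‖z‖ := by
          have h := norm_le_pi_norm z (Fin.last j)
          rwa [hz, Fin.snoc_last] at h
        have hG' : ‖z‖ ^ (kl.1 + kl'.1) * ‖iteratedFDeriv ℝ (kl.2 + kl'.2) G z‖ ≤ schwartzNorm (a + t) G :=
          (SchwartzMap.le_seminorm ℂ _ _ G z).trans
            (seminorm_le_schwartzNorm (add_le_add hk hk') (add_le_add hl hl') G)
        calc ‖y‖ ^ kl'.1 * ‖iteratedFDeriv ℝ kl'.2 φ y w‖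
            = ‖x'‖ ^ kl.1 * ‖y‖ ^ kl'.1 *
                ‖(∂^{fun i => (Fin.snoc (v i) 0 : Fin (j + 1) → E)} H) z‖ := by
              rw [hmixed, norm_mul, Complex.norm_real, Real.norm_eq_abs, abs_of_nonneg (by positivity)]
              ring
          _ ≤ ‖z‖ ^ kl.1 * ‖z‖ ^ kl'.1 *
                ((∏ i, ‖w i‖) * ‖iteratedFDeriv ℝ (kl.2 + kl'.2) G z‖ * ∏ i, ‖v i‖) := by
              gcongr
          _ = (‖z‖ ^ (kl.1 + kl'.1) * ‖iteratedFDeriv ℝ (kl.2 + kl'.2) G z‖) *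
                (∏ i, ‖v i‖) * ∏ i, ‖w i‖ := by rw [pow_add]; ring
          _ ≤ schwartzNorm (a + t) G * (∏ i, ‖v i‖) * ∏ i, ‖w i‖ := by gcongr
      calc ‖y‖ ^ kl'.1 * ‖iteratedFDeriv ℝ kl'.2 φ y‖
          = ‖(‖y‖ ^ kl'.1 : ℝ) • iteratedFDeriv ℝ kl'.2 φ y‖ := by
            rw [norm_smul, Real.norm_eq_abs, abs_of_nonneg (by positivity)]
        _ ≤ schwartzNorm (a + t) G * ∏ i, ‖v i‖ := by
            refine ContinuousMultilinearMap.opNorm_le_bound hC0 fun w => ?_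
            rw [smul_apply, norm_smul, Real.norm_eq_abs,
              abs_of_nonneg (by positivity)]
            exact hw w
    calc ‖x'‖ ^ kl.1 * ‖iteratedFDeriv ℝ kl.2 Gl x' v‖ = ‖lam φ‖ := hnorm
      _ ≤ L * schwartzNorm t φ := hlam φ
      _ ≤ L * (schwartzNorm (a + t) G * ∏ i, ‖v i‖) := mul_le_mul_of_nonneg_left hφt hL
      _ = L * schwartzNorm (a + t) G * ∏ i, ‖v i‖ := by ring
  calc ‖x'‖ ^ kl.1 * ‖iteratedFDeriv ℝ kl.2 Gl x'‖
      = ‖(‖x'‖ ^ kl.1 : ℝ) • iteratedFDeriv ℝ kl.2 Gl x'‖ := by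
        rw [norm_smul, Real.norm_eq_abs, abs_of_nonneg (by positivity)]
    _ ≤ L * schwartzNorm (a + t) G := by
        refine ContinuousMultilinearMap.opNorm_le_bound hB0 fun v => ?_
        rw [smul_apply, norm_smul, Real.norm_eq_abs,
          abs_of_nonneg (by positivity)]
        exact key v

end Combination

end Literature.MathematicalPhysics.QuantumLattice
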